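import Summits.HodgeConjecture.CorCM.SexticOcticWeilFrameTransfer
import Summits.HodgeConjecture.CorCM.Census.SexticOcticWeilExtraction
import Summits.HodgeConjecture.CorCM.OcticWeil13PairEightfoldParts
import Summits.HodgeConjecture.CorCM.CMWeightPushforwardExtraction
import HarnessLib

/-!
# COR-CM — `E × T × B` over a sextic and an octic CM field sharing `k`: the TENFOLD parts (the three labels of `T` of sign `b` TWICE and the
# four labels of `B` of sign `¬b` — the Weil weight of `T × T × B̄`) have algebraic lines, GIVEN the four and six parts of `X⁺ = E⁴ ⊞ X`, by
# PUSH–PULL through four fresh curves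

Cell `pub-hodgecm2` (COR-CM), seat b30 gen 26 (2026-08-23); count-neutral own lane SEXTIC-OCTIC.  Theorems + one bookkeeping definition
(`extS₄`, four fresh curve slots in front — the three-slot twin of gen 25's `OcticWeilMulti.extO₄`); no named fact, no `sorry`.  For
`X = ⨁_j A(κ j)` and a ten part `G = G₀ ⊔ G₁ ⊔ G₂` of sign `b` (`G₀`, `G₁` three parts of sign `b` on two copies of `T`, `G₂` a quad part of sign
`¬b`): on `X⁺ = ⨁_l A(extS₄ κ l)` with `T = {(0,τ_b), (1,τ_b), (2,τ_{¬b}), (3,τ_{¬b})}`,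
`σ G ⊔ T = (σ G₀ ⊔ {(0,τ_b)}) ⊔ (σ G₁ ⊔ {(1,τ_b)}) ⊔ (σ G₂ ⊔ {(2,τ_{¬b}), (3,τ_{¬b})})` is a disjoint union of two FOUR parts of sign `b`
(the Weil weight of `T × E`, twice) and a SIX part of sign `¬b` (the Weil weight of `B̄ × Ē × Ē`) — algebraic by the hypotheses `hfour`, `hsix`
(discharged downstream from Markman's theorems) — and the complementary weight `T' = {(0,τ_{¬b}), (2,τ_b)} ⊔ {(1,τ_{¬b}), (3,τ_b)}` is two
conjugate PAIRS of curve coordinates.  The push-forward extraction lemma (P1) then gives the line of `G` on `X` (codimension `5`).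

* §1 `extS₄ κ = (0, 0, 0, 0, κ)` (`Fin.cons`, so that `extS₄ κ (j+4)` is DEFINITIONALLY `κ j`);
* §2 **`weightClassesAlg_le_algebraicClasses_of_isTenPartS`** — THE LEMMA.
HONEST FRAMING: nothing about the Hodge conjecture is concluded in this file; `HC_CM` is not asserted.
[cite: Schoen1998HodgeWeilAddendum, §10] [cite: Milne2020HodgeClassesAV, 1.2 (a) and Thm. 1] [cite: MoonenZarhin1995Duke, Thm. 2.4]
[cite: Gordon1999HodgeAVSurvey, 9.2.2]

## References
* [Schoen1998HodgeWeilAddendum] C. Schoen, Compositio Math. 114 (1998), §10.  [Milne2020HodgeClassesAV] J. S. Milne, arXiv:2010.08857,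
  1.2 (a), Thm. 1.  [MoonenZarhin1995Duke] B. Moonen, Yu. Zarhin, Duke Math. J. 77 (1995), Thm. 2.4.  [Gordon1999HodgeAVSurvey] B. B.
  Gordon, CRM Monogr. 10 (1999), 9.2.2.
-/

noncomputable section

open CategoryTheory CategoryTheory.Limits NumberField

namespace Summit.HodgeConjecture.CorCM.SexticOcticWeil

open Literature.AlgebraicGeometry Literature.AlgebraicGeometry.Motives Literature.AlgebraicGeometry.HodgeTheory
open Literature.AlgebraicGeometry.ComplexMultiplication (IsCMTypeRealisation)
open Literature.AlgebraicGeometry.Pohlmann1968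
open Literature.NumberTheory.ComplexMultiplication
open Summit.HodgeConjecture.CorCM.Census.SexticOcticWeil (PtS cjS cjS_inl IsPairPartS IsThreePartS IsQuadPartS IsFourPartS IsSixPartS
  IsTenPartS)
open Summit.HodgeConjecture.CorCM.OcticWeil13Pair (succ₄_injective eq_of_not_mem_range_succ₄ not_mem_range_succ₄
  decide_tauSign_eq exists_eq_tauSign tauSign_not_ne)
open Summit.HodgeConjecture.CorCM.CMWeights (weightClassesAlg_le_algebraicClasses_of_pushforward sigma_map_injective)
open Summit.HodgeConjecture.CorCM.PairWeights (weightClassesAlg_union_le_algebraicClasses)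

open scoped Classical

/-! ## §1 Four fresh curve slots in front -/

/-- **Four fresh curve slots in front of a slot map** (three atoms `E, T, B`): `extS₄ κ = (0, 0, 0, 0, κ)` as an iterated `Fin.cons`, so that
`extS₄ κ j.succ.succ.succ.succ` is DEFINITIONALLY `κ j` and `extS₄ κ 0, …, extS₄ κ 3` are DEFINITIONALLY the curve slot `0`. [folklore] -/
def extS₄ {N : ℕ} (κ : Fin N → Fin 3) : Fin (N + 4) → Fin 3 :=
  Fin.cons 0 (Fin.cons 0 (Fin.cons 0 (Fin.cons 0 κ : Fin (N + 1) → Fin 3) : Fin (N + 2) → Fin 3) : Fin (N + 3) → Fin 3)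

/-- The embedding of the old slots: `e₄ j = j + 4`. [folklore] -/
theorem extS₄_succ {N : ℕ} (κ : Fin N → Fin 3) (j : Fin N) : extS₄ κ j.succ.succ.succ.succ = κ j := rfl

section Tenfold

variable {I : Type} {Kf : I → Type} [∀ i, Field (Kf i)] [∀ i, NumberField (Kf i)] [∀ i, IsCMField (Kf i)]
  {i₀ i₁ i₂ : I} {N : ℕ} (κ : Fin N → Fin 3) {e₁ : (Kf i₁ →+* ℂ) ≃ Fin 3 × Bool} {e₂ : (Kf i₂ →+* ℂ) ≃ Fin 4 × Bool}
  {τ : Kf i₀ →+* ℂ} (hττ : ComplexEmbedding.conjugate τ ≠ τ) (hk : ∀ σ : Kf i₀ →+* ℂ, σ = τ ∨ σ = ComplexEmbedding.conjugate τ)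
  (he₁_conj : ∀ s : Kf i₁ →+* ℂ, e₁ (ComplexEmbedding.conjugate s) = ((e₁ s).1, !(e₁ s).2))
  (he₂_conj : ∀ t : Kf i₂ →+* ℂ, e₂ (ComplexEmbedding.conjugate t) = ((e₂ t).1, !(e₂ t).2))
  {A : Fin 3 → AbelianVariety ℂ} {Φ : ∀ j : Fin 3, CMType (Kf (soSlots i₀ i₁ i₂ j))}
  {ι : ∀ j, 𝓞 (Kf (soSlots i₀ i₁ i₂ j)) →+* End (A j)}
  {θ : ∀ j, Kf (soSlots i₀ i₁ i₂ j) →+* Module.End ℂ (complexBetti (A j).X 1)}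
  (hA : ∀ j, IsCMTypeRealisation (Φ j) (A j) (ι j) (θ j))

/-! ## §2 The tenfold part has an algebraic line, given the four and six parts of `X⁺` -/

include hττ hk he₁_conj he₂_conj hA in
/-- **THE TENFOLD PART LEMMA.**  Let `X = ⨁_j A(κ j)` be a product of copies of `E, T, B` and `G` a ten part of sign `b` of a weight of `X`
(two points over each `(1, a, b)`, one over each `(2, a, ¬b)`).  IF on `X⁺ = E⁴ ⊞ X = ⨁_l A(extS₄ κ l)` every four part and every six part has
an algebraic line (`hfour`, `hsix`), THEN the line of `G` on `X` is algebraic (codimension `5`): push-pull through the four fresh curves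
(module docstring; `CMWeights.weightClassesAlg_le_algebraicClasses_of_pushforward`).
[cite: Schoen1998HodgeWeilAddendum, §10] [cite: Milne2020HodgeClassesAV, 1.2 (a) and Thm. 1] [cite: MoonenZarhin1995Duke, Thm. 2.4] -/
theorem weightClassesAlg_le_algebraicClasses_of_isTenPartS
    (hfour : ∀ (c : Bool) (G' : Finset ((l : Fin (N + 4)) × (Kf (soSlots i₀ i₁ i₂ (extS₄ κ l)) →+* ℂ))),
      IsFourPartS (fun x => toPtS e₁ e₂ τ ((Sigma.map (extS₄ κ) (fun _ => id) :
        ((l : Fin (N + 4)) × (Kf (soSlots i₀ i₁ i₂ (extS₄ κ l)) →+* ℂ)) → ((m : Fin 3) × (Kf (soSlots i₀ i₁ i₂ m) →+* ℂ))) x)) c G' →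
        weightClassesAlg (fun l => A (extS₄ κ l)) (fun l => ι (extS₄ κ l)) (2 * 2) G' ≤ algebraicClasses (⨁ fun l => A (extS₄ κ l)).X 2)
    (hsix : ∀ (c : Bool) (G' : Finset ((l : Fin (N + 4)) × (Kf (soSlots i₀ i₁ i₂ (extS₄ κ l)) →+* ℂ))),
      IsSixPartS (fun x => toPtS e₁ e₂ τ ((Sigma.map (extS₄ κ) (fun _ => id) :
        ((l : Fin (N + 4)) × (Kf (soSlots i₀ i₁ i₂ (extS₄ κ l)) →+* ℂ)) → ((m : Fin 3) × (Kf (soSlots i₀ i₁ i₂ m) →+* ℂ))) x)) c G' →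
        weightClassesAlg (fun l => A (extS₄ κ l)) (fun l => ι (extS₄ κ l)) (2 * 3) G' ≤ algebraicClasses (⨁ fun l => A (extS₄ κ l)).X 3)
    {b : Bool} {G : Finset ((j : Fin N) × (Kf (soSlots i₀ i₁ i₂ (κ j)) →+* ℂ))}
    (hG : IsTenPartS (fun x => toPtS e₁ e₂ τ ((Sigma.map κ (fun _ => id) :
      ((j : Fin N) × (Kf (soSlots i₀ i₁ i₂ (κ j)) →+* ℂ)) → ((m : Fin 3) × (Kf (soSlots i₀ i₁ i₂ m) →+* ℂ))) x)) b G) :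
    G.card = 2 * 5 ∧ weightClassesAlg (fun j => A (κ j)) (fun j => ι (κ j)) (2 * 5) G ≤
      algebraicClasses (⨁ fun j => A (κ j)).X 5 := by
  have hGcard : G.card = 2 * 5 := by rw [hG.1]
  refine ⟨hGcard, ?_⟩
  -- ### notation: the two index sets, the model maps, the embedding `e₄`
  let IX := (j : Fin N) × (Kf (soSlots i₀ i₁ i₂ (κ j)) →+* ℂ)
  let IP := (l : Fin (N + 4)) × (Kf (soSlots i₀ i₁ i₂ (extS₄ κ l)) →+* ℂ)
  let v : IX → PtS := fun x => toPtS e₁ e₂ τ ((Sigma.map κ (fun _ => id) :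
    IX → ((m : Fin 3) × (Kf (soSlots i₀ i₁ i₂ m) →+* ℂ))) x)
  let vP : IP → PtS := fun x => toPtS e₁ e₂ τ ((Sigma.map (extS₄ κ) (fun _ => id) :
    IP → ((m : Fin 3) × (Kf (soSlots i₀ i₁ i₂ m) →+* ℂ))) x)
  let e₄ : Fin N → Fin (N + 4) := fun j => j.succ.succ.succ.succ
  have he₄ : Function.Injective e₄ := succ₄_injective
  let σ₄ : IX ↪ IP := ⟨_, sigma_map_injective (K := fun l => Kf (soSlots i₀ i₁ i₂ (extS₄ κ l))) e₄ he₄⟩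
  have hvσ : ∀ x : IX, vP (σ₄ x) = v x := fun x => rfl
  have hσfst : ∀ x : IX, 4 ≤ ((σ₄ x).1 : ℕ) := fun x => by
    change 4 ≤ ((x.1.succ.succ.succ.succ : Fin (N + 4)) : ℕ)
    simp only [Fin.val_succ]; omega
  have hAP : ∀ l, IsCMTypeRealisation (Φ (extS₄ κ l)) (A (extS₄ κ l)) (ι (extS₄ κ l)) (θ (extS₄ κ l)) := fun l => hA (extS₄ κ l)
  -- ### the fresh curve coordinates
  let τs : Bool → (Kf i₀ →+* ℂ) := fun c => if c then τ else ComplexEmbedding.conjugate τ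
  have hτs : ∀ c, decide (τs c = τ) = c := fun c => decide_tauSign_eq hττ c
  have hτs_ne : ∀ c, τs (!c) ≠ τs c := fun c => tauSign_not_ne hττ c
  let p0 : Bool → IP := fun c => ⟨0, τs c⟩
  let p1 : Bool → IP := fun c => ⟨1, τs c⟩
  let p2 : Bool → IP := fun c => ⟨2, τs c⟩
  let p3 : Bool → IP := fun c => ⟨3, τs c⟩
  have hv0 : ∀ c, vP (p0 c) = Sum.inl c := fun c => by
    change toPtS (i₁ := i₁) (i₂ := i₂) e₁ e₂ τ ⟨0, τs c⟩ = _; rw [toPtS_zero, hτs]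
  have hv1 : ∀ c, vP (p1 c) = Sum.inl c := fun c => by
    change toPtS (i₁ := i₁) (i₂ := i₂) e₁ e₂ τ ⟨0, τs c⟩ = _; rw [toPtS_zero, hτs]
  have hv2 : ∀ c, vP (p2 c) = Sum.inl c := fun c => by
    change toPtS (i₁ := i₁) (i₂ := i₂) e₁ e₂ τ ⟨0, τs c⟩ = _; rw [toPtS_zero, hτs]
  have hv3 : ∀ c, vP (p3 c) = Sum.inl c := fun c => by
    change toPtS (i₁ := i₁) (i₂ := i₂) e₁ e₂ τ ⟨0, τs c⟩ = _; rw [toPtS_zero, hτs]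
  have hfst0 : ∀ c, ((p0 c).1 : ℕ) = 0 := fun c => rfl
  have hfst1 : ∀ c, ((p1 c).1 : ℕ) = 1 := fun c => rfl
  have hfst2 : ∀ c, ((p2 c).1 : ℕ) = 2 := fun c => rfl
  have hfst3 : ∀ c, ((p3 c).1 : ℕ) = 3 := fun c => rfl
  -- every coordinate of a fresh slot is one of the eight points
  have hfresh : ∀ x : IP, x.1 ∉ Set.range e₄ → ∃ c, x = p0 c ∨ x = p1 c ∨ x = p2 c ∨ x = p3 c := by
    rintro ⟨l, σ⟩ hl
    rcases eq_of_not_mem_range_succ₄ hl with rfl | rfl | rfl | rfl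
    · obtain ⟨c, hc⟩ := exists_eq_tauSign hk σ; exact ⟨c, Or.inl (by rw [hc])⟩
    · obtain ⟨c, hc⟩ := exists_eq_tauSign hk σ; exact ⟨c, Or.inr (Or.inl (by rw [hc]))⟩
    · obtain ⟨c, hc⟩ := exists_eq_tauSign hk σ; exact ⟨c, Or.inr (Or.inr (Or.inl (by rw [hc])))⟩
    · obtain ⟨c, hc⟩ := exists_eq_tauSign hk σ; exact ⟨c, Or.inr (Or.inr (Or.inr (by rw [hc])))⟩
  -- ### the weights `T = {p0 b, p1 b} ⊔ {p2 ¬b, p3 ¬b}` and `T' = {p0 ¬b, p2 b} ⊔ {p1 ¬b, p3 b}`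
  set T₁ : Finset IP := {p0 b, p1 b} with hT₁
  set T₂ : Finset IP := {p2 (!b), p3 (!b)} with hT₂
  set P₁ : Finset IP := {p0 (!b), p2 b} with hP₁
  set P₂ : Finset IP := {p1 (!b), p3 b} with hP₂
  have hne01 : ∀ c c', p0 c ≠ p1 c' := fun c c' h => by have := congrArg (fun x : IP => (x.1 : ℕ)) h; simp [hfst0, hfst1] at this
  have hne02 : ∀ c c', p0 c ≠ p2 c' := fun c c' h => by have := congrArg (fun x : IP => (x.1 : ℕ)) h; simp [hfst0, hfst2] at this
  have hne03 : ∀ c c', p0 c ≠ p3 c' := fun c c' h => by have := congrArg (fun x : IP => (x.1 : ℕ)) h; simp [hfst0, hfst3] at this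
  have hne12 : ∀ c c', p1 c ≠ p2 c' := fun c c' h => by have := congrArg (fun x : IP => (x.1 : ℕ)) h; simp [hfst1, hfst2] at this
  have hne13 : ∀ c c', p1 c ≠ p3 c' := fun c c' h => by have := congrArg (fun x : IP => (x.1 : ℕ)) h; simp [hfst1, hfst3] at this
  have hne23 : ∀ c c', p2 c ≠ p3 c' := fun c c' h => by have := congrArg (fun x : IP => (x.1 : ℕ)) h; simp [hfst2, hfst3] at this
  have hne00 : p0 (!b) ≠ p0 b := fun h => hτs_ne b (eq_of_heq (Sigma.mk.inj_iff.1 h).2)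
  have hne11 : p1 (!b) ≠ p1 b := fun h => hτs_ne b (eq_of_heq (Sigma.mk.inj_iff.1 h).2)
  have hne22 : p2 (!b) ≠ p2 b := fun h => hτs_ne b (eq_of_heq (Sigma.mk.inj_iff.1 h).2)
  have hne33 : p3 (!b) ≠ p3 b := fun h => hτs_ne b (eq_of_heq (Sigma.mk.inj_iff.1 h).2)
  have hT₁card : T₁.card = 2 := Finset.card_pair (hne01 b b)
  have hT₂card : T₂.card = 2 := Finset.card_pair (hne23 (!b) (!b))
  have hP₁card : P₁.card = 2 := Finset.card_pair (hne02 (!b) b)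
  have hP₂card : P₂.card = 2 := Finset.card_pair (hne13 (!b) b)
  have hT₁₂ : Disjoint T₁ T₂ := by
    rw [hT₁, hT₂, Finset.disjoint_left]
    intro x hx hx'
    simp only [Finset.mem_insert, Finset.mem_singleton] at hx hx'
    rcases hx with rfl | rfl <;> rcases hx' with h | h
    exacts [hne02 _ _ h, hne03 _ _ h, hne12 _ _ h, hne13 _ _ h]
  have hP₁₂ : Disjoint P₁ P₂ := by
    rw [hP₁, hP₂, Finset.disjoint_left]
    intro x hx hx'
    simp only [Finset.mem_insert, Finset.mem_singleton] at hx hx'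
    rcases hx with rfl | rfl <;> rcases hx' with h | h
    exacts [hne01 _ _ h, hne03 _ _ h, (hne12 _ _ h.symm).elim, hne23 _ _ h]
  set T : Finset IP := T₁ ∪ T₂ with hT
  set T' : Finset IP := P₁ ∪ P₂ with hT'
  have hTcard : T.card = 2 * 2 := by rw [hT, Finset.card_union_of_disjoint hT₁₂, hT₁card, hT₂card]
  have hT'card : T'.card = 2 * 2 := by rw [hT', Finset.card_union_of_disjoint hP₁₂, hP₁card, hP₂card]
  have hmemT : ∀ x, x ∈ T ↔ x = p0 b ∨ x = p1 b ∨ x = p2 (!b) ∨ x = p3 (!b) := fun x => by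
    simp only [hT, hT₁, hT₂, Finset.mem_union, Finset.mem_insert, Finset.mem_singleton, or_assoc]
  have hmemT' : ∀ x, x ∈ T' ↔ x = p0 (!b) ∨ x = p2 b ∨ x = p1 (!b) ∨ x = p3 b := fun x => by
    simp only [hT', hP₁, hP₂, Finset.mem_union, Finset.mem_insert, Finset.mem_singleton, or_assoc]
  have hTT' : Disjoint T T' := by
    rw [Finset.disjoint_left]
    intro x hx hx'
    rw [hmemT] at hx
    rw [hmemT'] at hx'
    rcases hx with rfl | rfl | rfl | rfl <;> rcases hx' with h | h | h | h
    exacts [hne00 h.symm, hne02 _ _ h, hne01 _ _ h, hne03 _ _ h, (hne01 _ _ h.symm).elim, hne12 _ _ h, hne11 h.symm,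
      hne13 _ _ h, (hne02 _ _ h.symm).elim, hne22 (h ▸ rfl), (hne12 _ _ h.symm).elim, hne23 _ _ h,
      (hne03 _ _ h.symm).elim, (hne23 _ _ h.symm).elim, (hne13 _ _ h.symm).elim, hne33 (h ▸ rfl)]
  -- `T ⊔ T'` = all coordinates off the old slots
  have hfreshT : ∀ x : IP, (x ∈ T ∨ x ∈ T') → x.1 ∉ Set.range e₄ := by
    intro x hx
    apply not_mem_range_succ₄
    rcases hx with hx | hx
    · rw [hmemT] at hx
      rcases hx with rfl | rfl | rfl | rfl
      · rw [hfst0]; norm_num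
      · rw [hfst1]; norm_num
      · rw [hfst2]; norm_num
      · rw [hfst3]; norm_num
    · rw [hmemT'] at hx
      rcases hx with rfl | rfl | rfl | rfl
      · rw [hfst0]; norm_num
      · rw [hfst2]; norm_num
      · rw [hfst1]; norm_num
      · rw [hfst3]; norm_num
  have hcov : ∀ x : IP, (x ∈ T ∨ x ∈ T') ↔ x.1 ∉ Set.range e₄ := by
    intro x
    refine ⟨hfreshT x, fun hx => ?_⟩
    obtain ⟨c, hc⟩ := hfresh x hx
    rw [hmemT, hmemT']
    by_cases hcb : c = b
    · subst hcb
      rcases hc with h | h | h | h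
      · exact Or.inl (Or.inl h)
      · exact Or.inl (Or.inr (Or.inl h))
      · exact Or.inr (Or.inr (Or.inl h))
      · exact Or.inr (Or.inr (Or.inr (Or.inr h)))
    · have hcb' : c = !b := by cases c <;> cases b <;> simp_all
      subst hcb'
      rcases hc with h | h | h | h
      · exact Or.inr (Or.inl h)
      · exact Or.inr (Or.inr (Or.inr (Or.inl h)))
      · exact Or.inl (Or.inr (Or.inr (Or.inl h)))
      · exact Or.inl (Or.inr (Or.inr (Or.inr h)))
  -- ### `T'` is two conjugate pairs of curve coordinates: algebraic
  have hpair : ∀ (Q : Finset IP) (x y : IP), Q = {x, y} → x ≠ y → vP x = Sum.inl (!b) → vP y = Sum.inl b →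
      Q.card = 2 * 1 ∧ weightClassesAlg (fun l => A (extS₄ κ l)) (fun l => ι (extS₄ κ l)) (2 * 1) Q ≤
        algebraicClasses (⨁ fun l => A (extS₄ κ l)).X 1 := by
    rintro Q x y rfl hxy hx hy
    refine weightClassesAlg_le_algebraicClasses_of_isPairPartS (extS₄ κ) hττ hk he₁_conj he₂_conj hA ⟨Sum.inl (!b),
      Finset.card_pair hxy, ?_, ?_⟩
    · intro z hz z' hz' h
      simp only [Finset.coe_insert, Finset.coe_singleton, Set.mem_insert_iff, Set.mem_singleton_iff] at hz hz'
      rcases hz with rfl | rfl <;> rcases hz' with rfl | rfl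
      · rfl
      · exact absurd (hx.symm.trans (h.trans hy)) (by cases b <;> simp)
      · exact absurd (hy.symm.trans (h.trans hx)) (by cases b <;> simp)
      · rfl
    · rw [Finset.image_insert, Finset.image_singleton, cjS_inl, Bool.not_not]
      change ({vP x, vP y} : Finset PtS) = _
      rw [hx, hy]
  have halg₂ : weightClassesAlg (fun l => A (extS₄ κ l)) (fun l => ι (extS₄ κ l)) (2 * 2) T' ≤
      algebraicClasses (⨁ fun l => A (extS₄ κ l)).X 2 := by
    obtain ⟨h1c, h1a⟩ := hpair P₁ (p0 (!b)) (p2 b) hP₁ (hne02 _ _) (hv0 _) (hv2 _)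
    obtain ⟨h2c, h2a⟩ := hpair P₂ (p1 (!b)) (p3 b) hP₂ (hne13 _ _) (hv1 _) (hv3 _)
    have h := weightClassesAlg_union_le_algebraicClasses hAP (a := 1) (b := 1) (p := 2) rfl h1c h2c hP₁₂ h1a h2a
    rwa [Finset.disjUnion_eq_union] at h
  -- ### `σ G ⊔ T` is two four parts ⊔ a six part: algebraic
  obtain ⟨G₀, G₁, G₂, hG₀₁, hG₀₂, hG₁₂, hGU, hW₀, hW₁, hW₂⟩ := hG.exists_split
  have hfourpart : ∀ (W : Finset IX) (x : IP), IsThreePartS v b W → vP x = Sum.inl b → ((x.1 : ℕ) < 4) →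
      Disjoint (W.map σ₄) {x} ∧ IsFourPartS vP b (W.map σ₄ ∪ {x}) := by
    intro W x hW hx hx4
    have hdisj : Disjoint (W.map σ₄) {x} := by
      rw [Finset.disjoint_singleton_right]
      intro hz
      obtain ⟨w, -, hw⟩ := Finset.mem_map.1 hz
      have h4 := hσfst w
      rw [hw] at h4; omega
    refine ⟨hdisj, ?_, ?_, fun a => ?_⟩
    · rw [Finset.card_union_of_disjoint hdisj, Finset.card_map, hW.1, Finset.card_singleton]
    · have hF : ∀ z ∈ W.map σ₄, ¬ vP z = Sum.inl b := fun z hz => by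
        obtain ⟨w, hw, rfl⟩ := Finset.mem_map.1 hz
        obtain ⟨a, ha⟩ := hW.exists_eq hw
        change vP (σ₄ w) ≠ _
        rw [hvσ, show v w = Sum.inr (Sum.inl (a, b)) from ha]
        exact Sum.inr_ne_inl
      rw [Finset.filter_union, Finset.filter_false_of_mem hF, Finset.empty_union,
        Finset.filter_true_of_mem (fun z hz => by rw [Finset.mem_singleton.1 hz]; exact hx), Finset.card_singleton]
    · have hF : ∀ z ∈ ({x} : Finset IP), ¬ vP z = Sum.inr (Sum.inl (a, b)) := fun z hz => by
        rw [Finset.mem_singleton.1 hz, show vP x = _ from hx]; exact Sum.inl_ne_inr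
      rw [Finset.filter_union, Finset.filter_false_of_mem hF, Finset.union_empty, Finset.filter_map, Finset.card_map, ← hW.2 a]
      exact congrArg Finset.card (Finset.filter_congr fun w _ => by rw [Function.comp_apply, hvσ])
  have hsixpart : ∀ (W : Finset IX) (x y : IP), IsQuadPartS v (!b) W → x ≠ y → vP x = Sum.inl (!b) → vP y = Sum.inl (!b) →
      ((x.1 : ℕ) < 4) → ((y.1 : ℕ) < 4) → Disjoint (W.map σ₄) {x, y} ∧ IsSixPartS vP (!b) (W.map σ₄ ∪ {x, y}) := by
    intro W x y hW hxy hx hy hx4 hy4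
    have hdisj : Disjoint (W.map σ₄) {x, y} := by
      rw [Finset.disjoint_left]
      intro z hz hz'
      obtain ⟨w, -, rfl⟩ := Finset.mem_map.1 hz
      simp only [Finset.mem_insert, Finset.mem_singleton] at hz'
      have h4 := hσfst w
      rcases hz' with h | h
      · rw [h] at h4; omega
      · rw [h] at h4; omega
    refine ⟨hdisj, ?_, ?_, fun a => ?_⟩
    · rw [Finset.card_union_of_disjoint hdisj, Finset.card_map, hW.1, Finset.card_pair hxy]
    · have hF : ∀ z ∈ W.map σ₄, ¬ vP z = Sum.inl (!b) := fun z hz => by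
        obtain ⟨w, hw, rfl⟩ := Finset.mem_map.1 hz
        obtain ⟨a, ha⟩ := hW.exists_eq hw
        change vP (σ₄ w) ≠ _
        rw [hvσ, show v w = Sum.inr (Sum.inr (a, !b)) from ha]
        exact Sum.inr_ne_inl
      have hTr : ∀ z ∈ ({x, y} : Finset IP), vP z = Sum.inl (!b) := fun z hz => by
        simp only [Finset.mem_insert, Finset.mem_singleton] at hz
        rcases hz with rfl | rfl
        exacts [hx, hy]
      rw [Finset.filter_union, Finset.filter_false_of_mem hF, Finset.empty_union, Finset.filter_true_of_mem hTr,
        Finset.card_pair hxy]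
    · have hF : ∀ z ∈ ({x, y} : Finset IP), ¬ vP z = Sum.inr (Sum.inr (a, !b)) := fun z hz => by
        simp only [Finset.mem_insert, Finset.mem_singleton] at hz
        rcases hz with rfl | rfl
        · rw [show vP _ = _ from hx]; exact Sum.inl_ne_inr
        · rw [show vP _ = _ from hy]; exact Sum.inl_ne_inr
      rw [Finset.filter_union, Finset.filter_false_of_mem hF, Finset.union_empty, Finset.filter_map, Finset.card_map, ← hW.2 a]
      exact congrArg Finset.card (Finset.filter_congr fun w _ => by rw [Function.comp_apply, hvσ])
  obtain ⟨hd₀, hS₀⟩ := hfourpart G₀ (p0 b) hW₀ (hv0 _) (by rw [hfst0]; norm_num)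
  obtain ⟨hd₁, hS₁⟩ := hfourpart G₁ (p1 b) hW₁ (hv1 _) (by rw [hfst1]; norm_num)
  obtain ⟨hd₂, hS₂⟩ := hsixpart G₂ (p2 (!b)) (p3 (!b)) hW₂ (hne23 _ _) (hv2 _) (hv3 _) (by rw [hfst2]; norm_num)
    (by rw [hfst3]; norm_num)
  -- disjointness of the three parts
  have hmap_not : ∀ (W : Finset IX) (q : IP), (q.1 : ℕ) < 4 → q ∉ W.map σ₄ := fun W q hq hz => by
    obtain ⟨w, -, hw⟩ := Finset.mem_map.1 hz
    have h4 := hσfst w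
    rw [hw] at h4; omega
  have hS₀₁ : Disjoint (G₀.map σ₄ ∪ {p0 b}) (G₁.map σ₄ ∪ {p1 b}) := by
    rw [Finset.disjoint_union_left, Finset.disjoint_union_right, Finset.disjoint_union_right]
    refine ⟨⟨(Finset.disjoint_map σ₄).2 hG₀₁, Finset.disjoint_singleton_right.2 (hmap_not G₀ _ (by rw [hfst1]; norm_num))⟩,
      Finset.disjoint_singleton_left.2 (hmap_not G₁ _ (by rw [hfst0]; norm_num)), Finset.disjoint_singleton.2 (hne01 b b)⟩
  have hS₀₁₂ : Disjoint ((G₀.map σ₄ ∪ {p0 b}).disjUnion (G₁.map σ₄ ∪ {p1 b}) hS₀₁) (G₂.map σ₄ ∪ {p2 (!b), p3 (!b)}) := by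
    rw [Finset.disjUnion_eq_union, Finset.disjoint_union_left, Finset.disjoint_union_left, Finset.disjoint_union_left,
      Finset.disjoint_union_right, Finset.disjoint_union_right, Finset.disjoint_union_right, Finset.disjoint_union_right]
    refine ⟨⟨⟨(Finset.disjoint_map σ₄).2 hG₀₂, ?_⟩, ⟨Finset.disjoint_singleton_left.2 (hmap_not G₂ _ (by rw [hfst0]; norm_num)), ?_⟩⟩,
      ⟨(Finset.disjoint_map σ₄).2 hG₁₂, ?_⟩, ⟨Finset.disjoint_singleton_left.2 (hmap_not G₂ _ (by rw [hfst1]; norm_num)), ?_⟩⟩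
    · rw [Finset.disjoint_left]
      intro z hz hz'
      simp only [Finset.mem_insert, Finset.mem_singleton] at hz'
      rcases hz' with rfl | rfl
      · exact hmap_not G₀ _ (by rw [hfst2]; norm_num) hz
      · exact hmap_not G₀ _ (by rw [hfst3]; norm_num) hz
    · rw [Finset.disjoint_left]
      intro z hz hz'
      rw [Finset.mem_singleton] at hz
      subst hz
      simp only [Finset.mem_insert, Finset.mem_singleton] at hz'
      rcases hz' with h | h
      exacts [hne02 _ _ h, hne03 _ _ h]
    · rw [Finset.disjoint_left]
      intro z hz hz'
      simp only [Finset.mem_insert, Finset.mem_singleton] at hz'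
      rcases hz' with rfl | rfl
      · exact hmap_not G₁ _ (by rw [hfst2]; norm_num) hz
      · exact hmap_not G₁ _ (by rw [hfst3]; norm_num) hz
    · rw [Finset.disjoint_left]
      intro z hz hz'
      rw [Finset.mem_singleton] at hz
      subst hz
      simp only [Finset.mem_insert, Finset.mem_singleton] at hz'
      rcases hz' with h | h
      exacts [hne12 _ _ h, hne13 _ _ h]
  have hunion : G.map σ₄ ∪ T =
      ((G₀.map σ₄ ∪ {p0 b}).disjUnion (G₁.map σ₄ ∪ {p1 b}) hS₀₁).disjUnion (G₂.map σ₄ ∪ {p2 (!b), p3 (!b)}) hS₀₁₂ := by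
    rw [Finset.disjUnion_eq_union, Finset.disjUnion_eq_union, hGU, Finset.map_union, Finset.map_union, hT, hT₁,
      Finset.insert_eq, Finset.union_union_union_comm (G₀.map σ₄ ∪ G₁.map σ₄), Finset.union_union_union_comm (G₀.map σ₄)]
  have halg₀₁ : weightClassesAlg (fun l => A (extS₄ κ l)) (fun l => ι (extS₄ κ l)) (2 * 4)
      ((G₀.map σ₄ ∪ {p0 b}).disjUnion (G₁.map σ₄ ∪ {p1 b}) hS₀₁) ≤ algebraicClasses (⨁ fun l => A (extS₄ κ l)).X 4 :=
    weightClassesAlg_union_le_algebraicClasses hAP (a := 2) (b := 2) (p := 4) rfl hS₀.1 hS₁.1 hS₀₁ (hfour b _ hS₀) (hfour b _ hS₁)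
  have hcard₀₁ : ((G₀.map σ₄ ∪ {p0 b}).disjUnion (G₁.map σ₄ ∪ {p1 b}) hS₀₁).card = 2 * 4 := by
    rw [Finset.card_disjUnion, hS₀.1, hS₁.1]
  have halg₁ : weightClassesAlg (fun l => A (extS₄ κ l)) (fun l => ι (extS₄ κ l)) (2 * (5 + 2)) (G.map σ₄ ∪ T) ≤
      algebraicClasses (⨁ fun l => A (extS₄ κ l)).X (5 + 2) := by
    rw [hunion]
    exact weightClassesAlg_union_le_algebraicClasses hAP (a := 4) (b := 3) (p := 5 + 2) rfl hcard₀₁ hS₂.1 hS₀₁₂ halg₀₁ (hsix (!b) _ hS₂)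
  -- ### push-pull
  exact weightClassesAlg_le_algebraicClasses_of_pushforward (A := fun l => A (extS₄ κ l))
    (Φ := fun l => Φ (extS₄ κ l)) (ι := fun l => ι (extS₄ κ l)) (θ := fun l => θ (extS₄ κ l)) hAP e₄ he₄
    (p := 5) (q := 2) (r := 2) hGcard hTcard hT'card hTT' hcov halg₁ halg₂

end Tenfold

end Summit.HodgeConjecture.CorCM.SexticOcticWeil

end
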